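import Summits.MatrixMultiplication.MatrixMultiplication.Theorems.AbelianSTPPCensusVQWitnesses

/-!
# The vQ-alive T_E list at order 483 in the kernel (cell mm-stpp, eng-2 g5; eng-1 g5 scan j274239, REF [203], planner scratch VQTE483)

Companion of `AbelianSTPPCensusVQWitnesses.lean` (kept separate for the 400-line rule).  eng-1's second oracle scan (wider alphabet)
lowered the explicit upper end of the cell's T_E bracket under the registered instrument vQ := vP ∧ E3⁺ from 490 to 483 with the list
`(8,6,6) + (7,7,6)² + (6,6,6) + (5,5,5)` (volumes `288, 294, 294, 216, 125`): vP-admissible at the composite order `483 = 3·7·23`,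
E3⁺-admissible under the kernel predicate `STPPThreeRoomEnergy.E3pAdm` (the fat members are `(8,6,6)` and the two `(7,7,6)`, the latter with
E3⁺ slack exactly `452`; `(6,6,6)` and `(5,5,5)` are silent), and beating `5/2`
(`288^{5/6} + 2·294^{5/6} + 216^{5/6} + 125^{5/6} ≥ 112 + 228 + 88.15 + 55.9 = 484.05 > 483`).
So `vqCensusTE_fails_at_483` (per-order ∃ form), `vqpCensusTE_false_above_483` (E3⁺ form, = the planner's scratch statement) and
`vqCensusTE_false_above_483` (E3 shape form).  Bracket of record after this: `468 < M*(T_E; vQ) ≤ 483` (lower end PROBE grade, eng-2 g4;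
upper end kernel).  WHAT THIS IS NOT: no existence claim for this shape list; no census number; no `ω` statement.
-/

-- single-conjunct summit: the mandated namespace repeats `MatrixMultiplication`.
set_option linter.dupNamespace false
set_option autoImplicit false

namespace Summit.MatrixMultiplication.MatrixMultiplication.Theorems

namespace AbelianSTPPCensusVP

open Finset STPPThreeRoomEnergy

/-- first sizes of the 483 witness `(8,6,6) + (7,7,6)² + (6,6,6) + (5,5,5)` (eng-1 g5, kit j274239) -/
def w483a : Fin 5 → ℕ := ![8, 7, 7, 6, 5]
/-- middle sizes of the 483 witness -/
def w483b : Fin 5 → ℕ := ![6, 7, 7, 6, 5]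
/-- last sizes of the 483 witness -/
def w483c : Fin 5 → ℕ := ![6, 6, 6, 6, 5]

/-- The 483 witness beats `5/2` (certified sixth-power bounds `112, 114, 88.15, 55.9`). [original] -/
theorem w483_beats : Beats (5 / 2) 483 w483a w483b w483c := by
  unfold Beats
  have h1 : (112 : ℝ) ≤ (288 : ℝ) ^ ((5 : ℝ) / 6) := le_rpow_five_sixths (by norm_num) (by norm_num) (by norm_num)
  have h2 : (114 : ℝ) ≤ (294 : ℝ) ^ ((5 : ℝ) / 6) := le_rpow_five_sixths (by norm_num) (by norm_num) (by norm_num)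
  have h3 : (88.15 : ℝ) ≤ (216 : ℝ) ^ ((5 : ℝ) / 6) := le_rpow_five_sixths (by norm_num) (by norm_num) (by norm_num)
  have h4 : (55.9 : ℝ) ≤ (125 : ℝ) ^ ((5 : ℝ) / 6) := le_rpow_five_sixths (by norm_num) (by norm_num) (by norm_num)
  have hexp : ((5 : ℝ) / 2 / 3) = (5 : ℝ) / 6 := by norm_num
  simp only [Fin.sum_univ_five, shapeVol, w483a, w483b, w483c, hexp]
  simp only [Matrix.cons_val_zero, Matrix.cons_val_one, Matrix.cons_val]
  norm_num
  linarith

set_option maxRecDepth 20000 in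
/-- The 483 witness is vP-admissible at the composite order 483 (vM by evaluation; U11-G in all three letter forms; U11-P not invoked).
[original] -/
theorem w483_admissible : SieveAdmissibleVP 483 w483a w483b w483c := by
  refine ⟨?_, ?_, fun hp => absurd hp (by norm_num)⟩
  · refine ⟨by decide, by decide, by decide, by decide, by decide, ?_, ?_⟩
    · intro l
      refine ⟨by revert l; decide, fun h => absurd h (by revert l; decide), by revert l; decide,
        fun h => absurd h (by revert l; decide), by revert l; decide, fun h => absurd h (by revert l; decide)⟩
    · intro l
      refine ⟨fun h _ => absurd h (by revert l; decide), fun h _ => absurd h (by revert l; decide),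
        fun h _ => absurd h (by revert l; decide)⟩
  · refine ⟨?_, ?_, ?_⟩ <;> (unfold U11GFormB; decide)

/-- The 483 witness is E3⁺-admissible (kernel predicate; the `(7,7,6)` members pass with slack `452`). [original] -/
theorem w483_e3pAdm : E3pAdm 483 w483a w483b w483c := by
  intro t _
  revert t
  decide

/-- E3⁺ slack of a `(7,7,6)` member of the 483 witness: off-member sums `S_A = 139`, `S_B = 151`, `S_C = 158`, `294² − e3pLHS = 452`.
[bookkeeping] -/
theorem w483_e3p_slack : 294 ^ 2 - e3pLHS 483 7 7 6 139 151 158 = 452 := by decide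

/-- **The instrument vQ is blind at order 483 for T_E.** [original] -/
theorem vqCensusTE_fails_at_483 :
    ∃ (N : ℕ) (a b c : Fin N → ℕ), 2 ≤ N ∧ SieveAdmissibleVP 483 a b c ∧ E3pAdm 483 a b c ∧ Beats (5 / 2) 483 a b c :=
  ⟨5, w483a, w483b, w483c, by norm_num, w483_admissible, w483_e3pAdm, w483_beats⟩

/-- **No vQ census statement for T_E reaches any order `M ≥ 483`** (E3⁺ form; = planner scratch VQTE483's statement). [original] -/
theorem vqpCensusTE_false_above_483 {M : ℕ} (hM : 483 ≤ M) :
    ¬ (∀ (N M' : ℕ) (a b c : Fin N → ℕ), 2 ≤ N → M' ≤ M → SieveAdmissibleVP M' a b c → E3pAdm M' a b c →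
        ¬ Beats (5 / 2) M' a b c) :=
  fun h => h 5 483 w483a w483b w483c (by norm_num) hM w483_admissible w483_e3pAdm w483_beats

/-- The same in the weaker E3 shape-form reading. [original] -/
theorem vqCensusTE_false_above_483 {M : ℕ} (hM : 483 ≤ M) :
    ¬ (∀ (N M' : ℕ) (a b c : Fin N → ℕ), 2 ≤ N → M' ≤ M → SieveAdmissibleVP M' a b c → TAKnap575.E3Adm M' a b c →
        ¬ Beats (5 / 2) M' a b c) :=
  fun h => h 5 483 w483a w483b w483c (by norm_num) hM w483_admissible (e3Adm_of_e3pAdm w483_e3pAdm) w483_beats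

end AbelianSTPPCensusVP

end Summit.MatrixMultiplication.MatrixMultiplication.Theorems
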